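import Summits.BirchSwinnertonDyer.BirchSwinnertonDyer.Theorems.SignedLowerHalvesSmallImageLowerHalfBothSignsRttD2SeqJ3LocalPairing
import Literature.NumberTheory.GaloisCohomology.LocalInvariantMapLevelChange
import Literature.NumberTheory.GaloisRepresentations.RelativeCorestrictionNaturality
import HarnessLib

/-!
# Route `SignedLowerHalves`, crux L `SmallImageLowerHalfBothSigns` (stmt-BirchSwinnertonDyer-23599), line `rtt_w3` v14 → v15 — E2, row J3
# (Galois side, part β₃a, continued): THE LEVEL LAW `red ⊣ incl` OF THE LOCAL TATE PAIRINGS OF THE LAYERS —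
# `⟨H¹(red) x′, ℓ⟩_{n,k} = ⟨x′, H¹(incl) ℓ⟩_{n,k+1}` — from the level compatibility of the local invariant maps `inv^{(p^k)} ⊂ inv^{(p^{k+1})}` (Serre XIII §3)

WIDTH seat `bsd-line-slh-p3-w3` g22 under LEAD `cruxlead-stmt-BirchSwinnertonDyer-23599` g11 (cell `bsd-ssimc`); helper `--supports stmt-BirchSwinnertonDyer-23599`.
DEFINITIONS WITH BODIES (`muAtInclHom`, `mixedPairing`) + THEOREMS; no named fact, no instance, no `sorry`. HONEST FRAMING: the fourth socket law of the local half of the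
inhabitant of `LayerPairing` (p784142); E2, crux L, crux M and BSD remain OPEN and are proved for NO curve.

* §1 `muAtInclHom v h : μₙ(K̄)|_{Γ_{K_v}} → μ_N(K̄)|_{Γ_{K_v}}` (`n ∣ N`) and its compatibility with the tree's `muLocalIso` / `muInclHom` of the local field;
  ★ `zmodToQmodZ_localInvariantMap_cohomologyMap_muAtInclHom` — level compatibility of `inv_v` on ARBITRARY local classes (the tree's `LocalInvariantMapLevelChange` states it for
  localisations of global classes; same proof: `invariantMap_muInclHom_compat_addCircle` for `K_v`), ★ `zmodToQmodZ_localInvariantMapSubgroup_cohomologyMap` — the same for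
  `inv_{U} = inv_v ∘ cor_U` on an open subgroup (`cor` is natural in coefficients, `cor_cohomologyMap_all`).
* §2 `mixedPairing` `X_{k′} × M[p^k] → μ_{p^k}`, `(x′, m) ↦ P_k(red x′, m)`; ★★ `pairLoc_red_incl`: if `P_{k′}(x′, incl m) = incl(P_k(red x′, m))` then
  `⟨H¹(red) x′, ℓ⟩_{n,k} = ⟨x′, H¹(incl) ℓ⟩_{n,k′}` (`cupProduct_mapPair` twice + §1), `H¹(incl)` on `H¹(U_n, M[p^k])` being the tree-side `torsIncl` (`rfl`).
References: [SerreLocalFields1979] XIII §3 Prop. 7, Cor. 3; [NeukirchSchmidtWingberg2008] I §5 Prop. 1.5.2–1.5.3, (7.1.4); [MilneADT2006] I §1–§2.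
-/

set_option autoImplicit false
set_option linter.dupNamespace false -- D-0017: single-problem summit, the namespace repeats the problem name by design
noncomputable section

open scoped Classical
open NumberField IsDedekindDomain Field CategoryTheory Function

namespace Summit.BirchSwinnertonDyer.BirchSwinnertonDyer.Theorems.SmallImageRttD2Seq

open Literature.NumberTheory.EllipticCurves Literature.NumberTheory.GaloisRepresentations Literature.NumberTheory.GaloisCohomology
open Literature.NumberTheory.GaloisRepresentations.DiscreteGaloisModule (mu MuCarrier)
open Literature.AnabelianGeometry.AbsoluteAnabelian Literature.AnabelianGeometry.AbsoluteAnabelian.Prop121vii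

/-! ## §1. Level change for the local invariant maps on arbitrary local classes -/

section Mu

variable {K : Type} [Field K] [NumberField K] (v : HeightOneSpectrum (𝓞 K)) {n N : ℕ} [NeZero n] [NeZero N] (h : n ∣ N)

/-- **`μₙ(K̄)|_{Γ_{K_v}} → μ_N(K̄)|_{Γ_{K_v}}`** (`n ∣ N`), the inclusion of roots of unity as a morphism of the local coefficient modules `muAt`. [cite: SerreLocalFields1979, XIII §3] -/
def muAtInclHom : (muAt K n v).toTopRep ⟶ (muAt K N v).toTopRep :=
  TopRep.ofHom ⟨⟨(muInclusion K h).toIntLinearMap, continuous_of_discreteTopology⟩, fun σ ↦ by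
    ext w
    apply muVal_injective K N
    change muVal K N (muInclusion K h (mu K n (absGaloisRestrict K (v.adicCompletion K) σ) w)) =
      muVal K N (mu K N (absGaloisRestrict K (v.adicCompletion K) σ) (muInclusion K h w))
    rw [muVal_apply, muInclusion, AddMonoidHom.coe_mk, ZeroHom.coe_mk, muVal_muOfUnit, muVal_muOfUnit, muVal_apply]⟩

omit [NeZero n] [NeZero N] in
/-- Values of `muAtInclHom`. [folklore] -/
theorem muAtInclHom_hom_apply (w : MuCarrier K n) : (muAtInclHom v h).hom w = muInclusion K h w := rfl

/-- **Compatibility of the transports `μ(K̄)|_v ≅ μ(K̄_v)` with the inclusions `μₙ ⊆ μ_N`.** [folklore] -/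
theorem muLocalIso_muAtInclHom :
    muAtInclHom v h ≫ (muLocalIso v N).hom = (muLocalIso v n).hom ≫ muInclHom (v.adicCompletion K) h := by
  ext w
  apply muVal_injective (v.adicCompletion K) N
  change muVal (v.adicCompletion K) N (muTransfer K (v.adicCompletion K) N (muInclusion K h w)) =
    muVal (v.adicCompletion K) N (muInclusion (v.adicCompletion K) h (muTransfer K (v.adicCompletion K) n w))
  rw [muVal_muTransfer, muInclusion, AddMonoidHom.coe_mk, ZeroHom.coe_mk, muVal_muOfUnit, muInclusion, AddMonoidHom.coe_mk, ZeroHom.coe_mk,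
    muVal_muOfUnit, muVal_muTransfer]

/-- ★ **Level compatibility of the local invariant map on ARBITRARY local classes, read in `ℚ/ℤ`**: for `c ∈ H²(K_v, μₙ)` and `n ∣ N`,
`inv_v^{(N)}(ι_* c)/N = inv_v^{(n)}(c)/n`. [cite: SerreLocalFields1979, XIII §3 Cor. 3] -/
theorem zmodToQmodZ_localInvariantMap_cohomologyMap_muAtInclHom (c : continuousCohomology 2 (muAt K n v).toTopRep) :
    zmodToQmodZ N (localInvariantMap K N v (cohomologyMap (muAtInclHom v h) 2 c)) = zmodToQmodZ n (localInvariantMap K n v c) := by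
  haveI : CharZero (v.adicCompletion K) := charZero_adicCompletion v
  have key₁ := cohomologyMap_comp_apply (muAtInclHom v h) (muLocalIso v N).hom 2 c
  have key₂ := cohomologyMap_comp_apply (muLocalIso v n).hom (muInclHom (v.adicCompletion K) h) 2 c
  rw [muLocalIso_muAtInclHom] at key₁
  have key : (cohomologyMap (muLocalIso v N).hom 2).hom (cohomologyMap (muAtInclHom v h) 2 c) =
      cohomologyMap (muInclHom (v.adicCompletion K) h) 2 ((cohomologyMap (muLocalIso v n).hom 2).hom c) := key₁.symm.trans key₂
  rw [localInvariantMap_apply, localInvariantMap_apply, key, zmodToQmodZ_apply, zmodToQmodZ_apply]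
  exact invariantMap_muInclHom_compat_addCircle (v.adicCompletion K) h _ _ (isInvariantMap_invLevel _ n) (isInvariantMap_invLevel _ N) _

variable (S : Subgroup (absoluteGaloisGroup (v.adicCompletion K))) [hS : IsClosed (S : Set (absoluteGaloisGroup (v.adicCompletion K)))]
  [Fintype (absoluteGaloisGroup (v.adicCompletion K) ⧸ S)]

/-- ★ **Level compatibility of `inv_U = inv_v ∘ cor_U` on an open subgroup `U ≤ Γ_{K_v}`**, read in `ℚ/ℤ` (`cor` is natural in the coefficient morphism `μₙ ⊆ μ_N`).
[cite: SerreLocalFields1979, XIII §3 Cor. 3] [cite: NeukirchSchmidtWingberg2008, I §5 Prop. 1.5.2] -/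
theorem zmodToQmodZ_localInvariantMapSubgroup_cohomologyMap [CompactSpace (absoluteGaloisGroup (v.adicCompletion K))]
    (c : continuousCohomology 2 ((muAt K n v).restrict (Literature.NumberTheory.GaloisRepresentations.subgroupIncl S)).toTopRep) :
    zmodToQmodZ N (localInvariantMapSubgroup K N v S (cohomologyMap (resModHom S (muAtInclHom v h)) 2 c)) =
      zmodToQmodZ n (localInvariantMapSubgroup K n v S c) := by
  rw [localInvariantMapSubgroup_apply, localInvariantMapSubgroup_apply]
  change zmodToQmodZ N (localInvariantMap K N v (cor S (muAt K N v) 2 (cohomologyMap (resModHom S (muAtInclHom v h)) 2 c))) = _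
  rw [cor_cohomologyMap_all S (muAt K n v) (muAt K N v) (muAtInclHom v h) 2 c]
  exact zmodToQmodZ_localInvariantMap_cohomologyMap_muAtInclHom v h _

end Mu

/-! ## §2. The level law `red ⊣ incl` of the local pairings -/

section Red

variable {K : Type} [Field K] [NumberField K] {p : ℕ} [Fact p.Prime] (κ : ZpExtension K p) (v : HeightOneSpectrum (𝓞 K))
  (M : Type) [AddCommGroup M] [DistribMulAction (absoluteGaloisGroup (v.adicCompletion K)) M] [TopologicalSpace M] [DiscreteTopology M]
  (hstab : ∀ m : M, IsOpen (MulAction.stabilizer (absoluteGaloisGroup (v.adicCompletion K)) m : Set (absoluteGaloisGroup (v.adicCompletion K))))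
  {MX : ℕ → Type} [∀ k, AddCommGroup (MX k)] [∀ k, TopologicalSpace (MX k)] [∀ k, DiscreteTopology (MX k)]
  (ρX : ∀ k : ℕ, ContinuousRep (absoluteGaloisGroup (v.adicCompletion K)) ℤ (MX k))
  (P : ∀ k : ℕ, ContPairing (ρX k).toTopRep (torsRep M hstab p k).toTopRep (muAt K (p ^ k) v).toTopRep)

/-- **The mixed pairing `X_{k′} × M[p^k] → μ_{p^k}`, `(x′, m) ↦ P_k(red x′, m)`** for an equivariant coefficient map `red : X_{k′} → X_k`. [cite: NeukirchSchmidtWingberg2008, I §5 Prop. 1.5.3] -/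
def mixedPairing {k k' : ℕ} (red : MX k' →+ MX k) (hred : ∀ (g : absoluteGaloisGroup (v.adicCompletion K)) (x : MX k'), red (ρX k' g x) = ρX k g (red x)) :
    ContPairing (ρX k').toTopRep (torsRep M hstab p k).toTopRep (muAt K (p ^ k) v).toTopRep where
  toLin := (P k).toLin.comp red.toIntLinearMap
  continuous_toLin := continuous_of_discreteTopology
  toLin_smul g x y := by
    change (P k).toLin (red (ρX k' g x)) ((torsRep M hstab p k).toTopRep.ρ g y) = _
    rw [hred]
    exact (P k).toLin_smul g (red x) y

/-- The coefficient morphism `(id, red)` between the restrictions to a subgroup `S`. [cite: NeukirchSchmidtWingberg2008, I §5] -/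
def redResHom (S : Subgroup (absoluteGaloisGroup (v.adicCompletion K))) {k k' : ℕ} (red : MX k' →+ MX k)
    (hred : ∀ (g : absoluteGaloisGroup (v.adicCompletion K)) (x : MX k'), red (ρX k' g x) = ρX k g (red x)) :
    TopRep.res ((ContinuousMonoidHom.id ↥S : ↥S →ₜ* ↥S) : ↥S →* ↥S) ((ρX k').restrict (Literature.NumberTheory.GaloisRepresentations.subgroupIncl S)).toTopRep ⟶
      ((ρX k).restrict (Literature.NumberTheory.GaloisRepresentations.subgroupIncl S)).toTopRep :=
  TopRep.ofHom ⟨⟨red.toIntLinearMap, continuous_of_discreteTopology⟩, fun g ↦ ContinuousLinearMap.ext fun x ↦ by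
    change red (ρX k' (g : absoluteGaloisGroup (v.adicCompletion K)) x) = ρX k (g : absoluteGaloisGroup (v.adicCompletion K)) (red x)
    exact hred _ x⟩

/-- **`H¹(red) : H¹(S, X_{k′}) → H¹(S, X_k)`.** [cite: NeukirchSchmidtWingberg2008, I §5] -/
def redMapH1 (S : Subgroup (absoluteGaloisGroup (v.adicCompletion K))) {k k' : ℕ} (red : MX k' →+ MX k)
    (hred : ∀ (g : absoluteGaloisGroup (v.adicCompletion K)) (x : MX k'), red (ρX k' g x) = ρX k g (red x)) :
    (continuousCohomology 1 ((ρX k').restrict (Literature.NumberTheory.GaloisRepresentations.subgroupIncl S)).toTopRep : Type) →+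
      (continuousCohomology 1 ((ρX k).restrict (Literature.NumberTheory.GaloisRepresentations.subgroupIncl S)).toTopRep : Type) :=
  (ContinuousCohomology.map (ContinuousMonoidHom.id ↥S) (redResHom v ρX S red hred) 1).hom.toLinearMap.toAddMonoidHom

/-- Unfolding `redMapH1`. [folklore] -/
theorem redMapH1_apply (S : Subgroup (absoluteGaloisGroup (v.adicCompletion K))) {k k' : ℕ} (red : MX k' →+ MX k)
    (hred : ∀ (g : absoluteGaloisGroup (v.adicCompletion K)) (x : MX k'), red (ρX k' g x) = ρX k g (red x))
    (a : continuousCohomology 1 ((ρX k').restrict (Literature.NumberTheory.GaloisRepresentations.subgroupIncl S)).toTopRep) :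
    redMapH1 v ρX S red hred a = ContinuousCohomology.map (ContinuousMonoidHom.id ↥S) (redResHom v ρX S red hred) 1 a :=
  rfl

omit [Fact p.Prime] in
/-- The coefficient inclusion `H¹(S, M[p^k]) → H¹(S, M[p^{k′}])` in the `ContinuousRep` dialect IS the tree-side `torsIncl` (definitional). [folklore] -/
theorem map_resHomOfEquivariant_inclusion_eq_torsIncl (S : Subgroup (absoluteGaloisGroup (v.adicCompletion K))) {k k' : ℕ} (hk : k ≤ k')
    (ℓ : subgroupH1 S ↥(torsionPow M p k)) :
    ContinuousCohomology.map (ContinuousMonoidHom.id ↥S)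
        (resHomOfEquivariant (ContinuousMonoidHom.id ↥S) (AddSubgroup.inclusion (torsionPow_mono (M := M) (p := p) hk)) fun _ _ ↦ rfl) 1 ℓ =
      torsIncl M p S hk ℓ :=
  rfl

variable [hcl : ∀ n : ℕ, IsClosed (localSubgroupOfEmb (κ.layerSubgroup n) (closureEmb (K := K) (v.adicCompletion K)) : Set (absoluteGaloisGroup (v.adicCompletion K)))]
  [hq : ∀ n : ℕ, Fintype (absoluteGaloisGroup (v.adicCompletion K) ⧸ localSubgroupOfEmb (κ.layerSubgroup n) (closureEmb (K := K) (v.adicCompletion K)))]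

/-- ★★ **The level law `⟨H¹(red) x′, ℓ⟩_{n,k} = ⟨x′, H¹(incl) ℓ⟩_{n,k′}`** (`k ≤ k′`), for an equivariant coefficient map `red : X_{k′} → X_k` with
`P_{k′}(x′, incl m) = incl(P_k(red x′, m))` (for `X = 𝒪 ⊗ μ ⊗ θ′`: `red = id ⊗ (ζ ↦ ζ^{p^{k′-k}})`): both sides are the invariant of the cup product for the mixed pairing, read
at the two levels (§1). [cite: NeukirchSchmidtWingberg2008, I §5 Prop. 1.5.3, (7.1.4)] [cite: SerreLocalFields1979, XIII §3 Cor. 3] -/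
theorem pairLoc_red_incl [CompactSpace (absoluteGaloisGroup (v.adicCompletion K))] (n : ℕ) {k k' : ℕ} (hk : k ≤ k') (red : MX k' →+ MX k)
    (hred : ∀ (g : absoluteGaloisGroup (v.adicCompletion K)) (x : MX k'), red (ρX k' g x) = ρX k g (red x))
    (hP : ∀ (x : MX k') (m : ↥(torsionPow M p k)),
      (P k').toLin x (AddSubgroup.inclusion (torsionPow_mono (M := M) (p := p) hk) m) = muInclusion K (pow_dvd_pow p hk) ((P k).toLin (red x) m))
    (x' : continuousCohomology 1 ((ρX k').restrict (Literature.NumberTheory.GaloisRepresentations.subgroupIncl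
        (localSubgroupOfEmb (κ.layerSubgroup n) (closureEmb (K := K) (v.adicCompletion K))))).toTopRep)
    (ℓ : continuousCohomology 1 ((torsRep M hstab p k).restrict (Literature.NumberTheory.GaloisRepresentations.subgroupIncl
        (localSubgroupOfEmb (κ.layerSubgroup n) (closureEmb (K := K) (v.adicCompletion K))))).toTopRep) :
    pairLoc κ v M hstab ρX P n k (redMapH1 v ρX _ red hred x') ℓ =
      pairLoc κ v M hstab ρX P n k' x' (ContinuousCohomology.map (ContinuousMonoidHom.id _)
        (resHomOfEquivariant (ContinuousMonoidHom.id _) (AddSubgroup.inclusion (torsionPow_mono (M := M) (p := p) hk)) fun _ _ ↦ rfl) 1 ℓ) := by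
  haveI : NeZero (p ^ k) := ⟨pow_ne_zero _ (Fact.out : p.Prime).ne_zero⟩
  haveI : NeZero (p ^ k') := ⟨pow_ne_zero _ (Fact.out : p.Prime).ne_zero⟩
  haveI : CompactSpace ↥(localSubgroupOfEmb (κ.layerSubgroup n) (closureEmb (K := K) (v.adicCompletion K))) :=
    isCompact_iff_compactSpace.mp (hcl n).isCompact
  -- (i) `red x′ ∪_{P_k} ℓ = x′ ∪_Q ℓ`
  have h1 := ContPairing.cupProduct_mapPair
    (resPairing (localSubgroupOfEmb (κ.layerSubgroup n) (closureEmb (K := K) (v.adicCompletion K))) (ρX k') (torsRep M hstab p k) (muAt K (p ^ k) v)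
      (mixedPairing v M hstab ρX P red hred))
    (resPairing (localSubgroupOfEmb (κ.layerSubgroup n) (closureEmb (K := K) (v.adicCompletion K))) (ρX k) (torsRep M hstab p k) (muAt K (p ^ k) v) (P k))
    (ContinuousMonoidHom.id _) (redResHom v ρX _ red hred) (idResHom _ _) (idResHom _ _) (fun _ _ ↦ rfl) x' ℓ
  rw [map_apply_of_id (ContinuousMonoidHom.id _) (fun _ ↦ rfl) (idResHom _ _) (fun _ ↦ rfl),
    map_apply_of_id (ContinuousMonoidHom.id _) (fun _ ↦ rfl) (idResHom _ _) (fun _ ↦ rfl)] at h1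
  -- (ii) `ι_*(x′ ∪_Q ℓ) = x′ ∪_{P_{k′}} incl ℓ`
  have h2 := ContPairing.cupProduct_mapPair
    (resPairing (localSubgroupOfEmb (κ.layerSubgroup n) (closureEmb (K := K) (v.adicCompletion K))) (ρX k') (torsRep M hstab p k) (muAt K (p ^ k) v)
      (mixedPairing v M hstab ρX P red hred))
    (resPairing (localSubgroupOfEmb (κ.layerSubgroup n) (closureEmb (K := K) (v.adicCompletion K))) (ρX k') (torsRep M hstab p k') (muAt K (p ^ k') v) (P k'))
    (ContinuousMonoidHom.id _) (idResHom _ _)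
    (resHomOfEquivariant (ContinuousMonoidHom.id _) (AddSubgroup.inclusion (torsionPow_mono (M := M) (p := p) hk)) fun _ _ ↦ rfl)
    (resIdHom (resModHom _ (muAtInclHom v (pow_dvd_pow p hk)))) (fun x m ↦ (hP x m).symm) x' ℓ
  rw [map_apply_of_id (ContinuousMonoidHom.id _) (fun _ ↦ rfl) (idResHom _ _) (fun _ ↦ rfl)] at h2
  rw [pairLoc_apply, pairLoc_apply, localPairingSubgroup_apply, localPairingSubgroup_apply, redMapH1_apply, ← h1,
    ← zmodToQmodZ_localInvariantMapSubgroup_cohomologyMap v (pow_dvd_pow p hk)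
      (localSubgroupOfEmb (κ.layerSubgroup n) (closureEmb (K := K) (v.adicCompletion K)))]
  exact congrArg (fun t ↦ zmodToQmodZ (p ^ k') (localInvariantMapSubgroup K (p ^ k') v
    (localSubgroupOfEmb (κ.layerSubgroup n) (closureEmb (K := K) (v.adicCompletion K))) t)) h2

end Red

end Summit.BirchSwinnertonDyer.BirchSwinnertonDyer.Theorems.SmallImageRttD2Seq

end
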